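import Mathlib.Analysis.Distribution.TemperedDistribution
import Mathlib.Analysis.Fourier.PoissonSummation
import Mathlib.Analysis.Calculus.BumpFunction.InnerProduct
import Literature.Geometry.DiscreteGeometry.MeyerSets
import Literature.MathematicalPhysics.QuantumLattice.SchwartzTranslationCutoff
import HarnessLib

/-!
# Crystalline measures and Fourier quasicrystals (Olevskii–Ulanovskii 2020)

Topic `Literature/Analysis/Fourier`. Definition request `defn-IsFourierQuasicrystal` (route
`RiemannHypothesis/BeurlingCrystalline`, items `stmt-RiemannHypothesis-22937` K4 `ThetaRigidity` and
`stmt-RiemannHypothesis-22935` K3): the notions *crystalline measure* / *Fourier quasicrystal* and the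
port of Olevskii–Ulanovskii, *Fourier quasicrystals with unit masses*, C. R. Math. Acad. Sci. Paris **358**
(2020), no. 11-12, 1207–1211 (doi:10.5802/crmath.142 = arXiv:2009.12810; bib key `OlevskiiUlanovskii2021`,
the online publication date — the decl prefix `OU2020` follows the volume year under which the paper is
universally cited). Page/line locators `pNNNN Lnn` refer to the held text `corpus:paper:arxiv-2009.12810`.

## Source, verbatim

* §1, p0003 L3–7 (definitions). "By a crystalline measure one means an atomic measure `μ` which is a
  tempered distribution and whose distributional Fourier transform is also an atomic measure,
  `μ = Σ_{λ∈Λ} c_λ δ_λ`, `μ̂ = Σ_{s∈S} a_s δ_s`, `c_λ, a_s ∈ ℂ`, where the support `Λ` and the spectrum `S`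
  of `μ` are locally finite sets. If in addition the measures `|μ|` and `|μ̂|` are also tempered, then `μ`
  is called a Fourier quasicrystal (FQ). A classical example of an FQ is a Dirac comb `μ = Σ_{n∈ℤ} δ_n`,
  which satisfies `μ̂ = μ`."
* §2, p0004 L3–7 (normalisation). "`ĥ(t) = ∫_ℝ e^{-2πitx} h(x) dx`" — this is Mathlib's `𝓕`
  (`Real.fourierIntegral`, kernel `e^{-2πi⟪v,w⟫}`), so no constant is rescaled below.
* §2, p0004 L11–18, **Proposition 1.** "Let `μ` be a positive measure which is a tempered distribution,
  such that its distributional Fourier transform `μ̂` is a measure satisfying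
  (2) `∫_{(-R,R)} d|μ̂| = O(R^m), R → ∞`, for some `m > 0`, which means that `|μ̂|` is a tempered
  distribution. Then there exists `C` such that (3) `μ(a,b) ≤ C(1 + b − a)`, `−∞ < a < b < ∞`."
* §2, p0004 L55–57. "a set `Λ ⊂ ℝ` is called uniformly discrete, if `inf_{λ≠λ'} |λ − λ'| > 0`" (printed
  with `sup`, an evident misprint for `inf`: cf. the authors' companion paper arXiv:2006.12037, §2 eq. (1),
  and the use made of it in Corollary 1). "A set `Λ` is called relatively uniformly discrete if it is a
  union of finite number of uniformly discrete sets."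
* §2, p0004 L61, **Corollary 1.** "Let `μ` be a measure of the form (1) [`μ = Σ_{λ∈Λ} δ_λ`] whose
  distributional Fourier transform is a measure satisfying (2). Then its support `Λ` is a relatively
  uniformly discrete set."
* §1, p0003 L29–33, **Theorem 1.** "Let `μ` be an FQ of the form (1) `μ = Σ_{λ∈Λ} δ_λ`. Then there is an
  exponential polynomial `p(x) = Σ_{k=1}^{n} b_k e^{iγ_k x}`, `n ∈ ℕ, b_k ∈ ℂ, γ_k ∈ ℝ`, with real simple
  zeros such that `Λ` is the zero set of `p`."
* §3, p0005 L114–120, **Remark 1.1.** "Some minor changes in the proof of Theorem 1 allow one to prove the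
  following extension of Theorem 1 to measures with integer masses, (10) `μ = Σ_{λ∈Λ} c_λ δ_λ, c_λ ∈ ℕ`:
  If such a measure is an FQ, then there is an exponential polynomial `p(x)` with imaginary frequencies
  and (not necessarily simple) real zeros such that `Λ` is the zero set of `p`."

## Rendering

* An *atomic measure with locally finite support* is rendered by its data: a set `Λ` (in a
  finite-dimensional real inner product space `V`; the paper has `V = ℝ`) with finitely many points in
  every ball (`IsLocallyFiniteSet`) and a mass function `c : V → ℂ` (only its values on `Λ` matter; the
  paper's `Λ` is the support, i.e. `c_λ ≠ 0` — the facts below quantify over the printed mass shapes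
  `c_λ = 1` / `c_λ ∈ ℕ`, for which this is automatic).  Complex masses of either sign are allowed, as
  printed, so Mathlib's (`ℝ≥0∞`-valued) `Measure` is not the carrier; a bridge for positive atomic
  measures is immediate from `MeasureTheory.Measure.sum`/`dirac` and is left to users.
* "`|μ|` is tempered" for such data is (2) verbatim: polynomial growth of the total variation on balls,
  `HasTemperedMasses Λ c : ∃ C N, ∀ R ≥ 1, Σ_{λ∈Λ, ‖λ‖≤R} ‖c_λ‖ ≤ C R^N` (closed balls and `R ≥ 1` in
  place of open intervals and `R → ∞`, and `N ∈ ℕ` in place of `m > 0`: equivalent normal forms for a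
  nondecreasing function of `R`).
* **Fourier quasicrystal** (`IsFourierQuasicrystal Λ c S a`) is rendered *elementarily*, as the
  requester asked: `Λ`, `S` locally finite, `|μ|` and `|μ̂|` tempered, and the distributional identity
  `μ̂ = Σ a_s δ_s` tested on Schwartz functions, `∀ φ ∈ 𝓢(V,ℂ), Σ_{λ∈Λ} c_λ (𝓕φ)(λ) = Σ_{s∈S} a_s φ(s)`
  (Mathlib: `⟪𝓕T, φ⟫ = ⟪T, 𝓕φ⟫`, `TemperedDistribution.fourier_apply`).  Under tempered masses both
  series converge absolutely for every Schwartz `φ` (`HasTemperedMasses.summable_mul_schwartz` below), so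
  the `tsum`s are genuine sums and the functional `φ ↦ Σ c_λ φ(λ)` *is* a tempered distribution
  (`IsFourierQuasicrystal.temperedDistribution`); hence this rendering is equivalent to the printed
  "crystalline + `|μ|`, `|μ̂|` tempered" (the converse direction uses density of `C_c^∞` in `𝓢`, in the
  tree as `Literature.Analysis.FunctionSpaces.TemperedDistribution.eq_of_forall_hasCompactSupport_apply_eq`).
* **Crystalline measure** (`IsCrystallineMeasure Λ c S a`), where the masses need not be absolutely
  summable against Schwartz functions, is rendered *faithfully through Mathlib's tempered distributions*
  `𝓢'(V, ℂ)`: there is a tempered distribution `T` which on compactly supported test functions is the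
  Radon measure `Σ c_λ δ_λ` and whose distributional Fourier transform `𝓕 T` is, on compactly supported
  test functions, the Radon measure `Σ a_s δ_s` (both finite sums there).  `IsFourierQuasicrystal ⇒
  IsCrystallineMeasure` is proved (`IsFourierQuasicrystal.isCrystallineMeasure`).
* *Exponential polynomial with imaginary frequencies*: `expPoly b γ z = Σ_k b_k e^{i γ_k z}` for
  `b : Fin n → ℂ`, `γ : Fin n → ℝ`, as an entire function of `z : ℂ`; "real simple zeros" = every complex
  zero is real and is not a zero of the derivative; "`Λ` is the zero set of `p`" = `Λ = {x : ℝ | p x = 0}`.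
* "uniformly discrete" is the tree's `Literature.Geometry.DiscreteGeometry.IsUniformlyDiscrete`
  (Konieczny 2023 §2.2; cited, not restated); "relatively uniformly discrete" = a finite union of such.
* Proposition 1 is printed for an arbitrary positive tempered measure `μ` whose distributional Fourier
  transform is a complex measure with tempered variation (not necessarily atomic).  It is rendered in
  Mathlib's measure language: `μ : Measure ℝ` with `μ.HasTemperateGrowth` (for a *positive* measure this
  is exactly "is a tempered distribution"), and `μ̂ = u · ρ` in polar form with `ρ : Measure ℝ` of
  temperate growth (`ρ ≥ |μ̂|`, so (2) holds; conversely take `ρ = |μ̂|`, `u = dμ̂/d|μ̂|`) and a measurable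
  density `‖u‖ ≤ 1`, the identity `μ̂ = u ρ` being tested on Schwartz functions, `∫ 𝓕φ dμ = ∫ φ u dρ`.
  Corollary 1 keeps this polar form for `μ̂` and takes `μ = Σ_{λ∈Λ} δ_λ` as the atomic datum `(Λ, 1)`
  (locally finite, tempered — i.e. `μ` is a tempered distribution), `⟨μ, 𝓕φ⟩ = Σ_{λ∈Λ} (𝓕φ)(λ)`.
  The Fourier-quasicrystal special cases (`μ̂` atomic) follow by taking `ρ = Σ_{s∈S} |a_s| δ_s`.

## Faithfulness sheet (typed vs printed)

| decl | printed | verdict |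
|---|---|---|
| `IsLocallyFiniteSet`, `HasTemperedMasses` | §1 "locally finite", §2 eq. (2) | FAITHFUL (normal form of (2)) |
| `IsCrystallineMeasure` | §1 p0003 L3–7 | FAITHFUL (via `𝓢'`) |
| `IsFourierQuasicrystal` | §1 p0003 L7 | FAITHFUL (equivalent elementary form, see Rendering) |
| `expPoly` | Thm 1 display | FAITHFUL |
| `OU2020_prop_1` | Prop. 1 | FAITHFUL (polar form of "`μ̂` is a measure with (2)"); PROVED `OU2020_prop_1_holds` |
| `OU2020_cor_1` | Cor. 1 | FAITHFUL (same polar form); PROVED `OU2020_cor_1_holds` |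
| `OU2020_thm_1` | Thm. 1 | FAITHFUL |
| `OU2020_rem_1_1` | Remark 1.1 | FAITHFUL; NB printed as a *remark* ("minor changes in the proof … allow one to prove"), `ℕ` = positive integers (masses of support points) |

NOT TYPED: Lemma 1 and eq. (5) (proof-internal resolvent identities); the converse statements (§1 last
paragraph and Remark 1.2: every exponential polynomial with imaginary frequencies and real (simple) zeros
is the support of an FQ with unit (resp. positive integer) masses), whose proofs are only referred to the
preprint arXiv:2006.12037 (its Cor. 2 proves the uniformly-discrete simple-zero case) — no dependant asks
for them; see also Favorov 2024 (arXiv:2411.07190) and Alon–Cohen–Vinzant for refereed converses.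

DISCHARGED HERE (our proofs of the cited statements): `OU2020_prop_1_holds` (the printed argument with
the test function `Σ_{j<m} ψ(· − a − j)` in place of `g ∗ 1_{(a−1/2,b+1/2)}`) and `OU2020_cor_1_holds`
(Proposition 1 for `Σ_{λ∈Λ} δ_λ` + residue classes of the counting function), with the Fourier-quasicrystal
forms `IsFourierQuasicrystal.exists_ncard_inter_Ioo_le` / `.isRelativelyUniformlyDiscrete`.
EQUIVALENCE OF RENDERINGS (proved here): `isFourierQuasicrystal_iff_isCrystallineMeasure` —
`IsFourierQuasicrystal Λ c S a ↔ IsCrystallineMeasure Λ c S a ∧ HasTemperedMasses Λ c ∧ HasTemperedMasses S a`,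
i.e. the elementary rendering *is* the printed "crystalline + `|μ|`, `|μ̂|` tempered".
`OU2020_thm_1` / `OU2020_rem_1_1` remain named facts (entire functions of order one, Phragmén–Lindelöf,
Paley–Wiener: not attempted).

Nothing in this file bears on the Riemann Hypothesis; the consumer route uses `OU2020_rem_1_1` as a
named hypothesis.
-/

namespace Literature.Analysis.Fourier

open scoped SchwartzMap FourierTransform
open _root_.MeasureTheory _root_.Set _root_.Filter
open scoped _root_.Topology
open Literature.Geometry.DiscreteGeometry (IsUniformlyDiscrete)

noncomputable section

/-! ### Locally finite sets and tempered masses -/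

/-- A subset `Λ` of a (pseudo)metric space is **locally finite**: every closed ball contains only
finitely many points of `Λ` (Olevskii–Ulanovskii 2020, §1: "the support `Λ` and the spectrum `S` of `μ`
are locally finite sets"). [cite: OlevskiiUlanovskii2021, §1 p.1207] -/
def IsLocallyFiniteSet {X : Type*} [PseudoMetricSpace X] (Λ : Set X) : Prop :=
  ∀ (x : X) (r : ℝ), (Λ ∩ Metric.closedBall x r).Finite

/-- Subsets of locally finite sets are locally finite (API for the notion of §1). [cite: OlevskiiUlanovskii2021, §1 p.1207] -/
theorem IsLocallyFiniteSet.subset {X : Type*} [PseudoMetricSpace X] {Λ Λ' : Set X}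
    (h : IsLocallyFiniteSet Λ) (h' : Λ' ⊆ Λ) : IsLocallyFiniteSet Λ' :=
  fun x r => (h x r).subset (inter_subset_inter_left _ h')

/-- Finite sets are locally finite (API for the notion of §1). [cite: OlevskiiUlanovskii2021, §1 p.1207] -/
theorem _root_.Set.Finite.isLocallyFiniteSet {X : Type*} [PseudoMetricSpace X] {Λ : Set X}
    (h : Λ.Finite) : IsLocallyFiniteSet Λ :=
  fun _ _ => h.subset inter_subset_left

/-- Finite unions of locally finite sets are locally finite (API for the notion of §1; cf. "relatively
uniformly discrete = finite union", §2). [cite: OlevskiiUlanovskii2021, §1 p.1207] -/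
theorem IsLocallyFiniteSet.union {X : Type*} [PseudoMetricSpace X] {Λ Λ' : Set X}
    (h : IsLocallyFiniteSet Λ) (h' : IsLocallyFiniteSet Λ') : IsLocallyFiniteSet (Λ ∪ Λ') := by
  intro x r
  rw [union_inter_distrib_right]
  exact (h x r).union (h' x r)

/-- In a (semi)normed group it suffices to test the balls centred at `0` (the paper's form: finitely
many points with `|λ| < R` for every `R`). [cite: OlevskiiUlanovskii2021, §1 p.1207] -/
theorem isLocallyFiniteSet_iff_closedBall_zero {E : Type*} [SeminormedAddCommGroup E] (Λ : Set E) :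
    IsLocallyFiniteSet Λ ↔ ∀ r : ℝ, (Λ ∩ Metric.closedBall (0 : E) r).Finite := by
  refine ⟨fun h r => h 0 r, fun h x r => (h (‖x‖ + r)).subset ?_⟩
  rintro y ⟨hy, hyr⟩
  refine ⟨hy, ?_⟩
  rw [Metric.mem_closedBall, dist_eq_norm] at hyr
  rw [mem_closedBall_zero_iff]
  calc ‖y‖ = ‖(y - x) + x‖ := by rw [sub_add_cancel]
    _ ≤ ‖y - x‖ + ‖x‖ := norm_add_le _ _
    _ ≤ r + ‖x‖ := by gcongr
    _ = ‖x‖ + r := add_comm _ _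

/-- **Tempered masses** (total variation of temperate growth) of atomic data `(Λ, c)`: the total mass
of `|μ| = Σ_{λ∈Λ} |c_λ| δ_λ` on the ball of radius `R` is `O(R^N)` — Olevskii–Ulanovskii 2020, eq. (2)
"`∫_{(-R,R)} d|μ̂| = O(R^m), R → ∞`, for some `m > 0`, which means that `|μ̂|` is a tempered
distribution", in the normal form `∀ R ≥ 1, Σ_{λ∈Λ, ‖λ‖ ≤ R} ‖c_λ‖ ≤ C R^N` (the sum is a `finsum`;
it is a genuine finite sum when `Λ` is locally finite). [cite: OlevskiiUlanovskii2021, §2 eq. (2)] -/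
def HasTemperedMasses {E : Type*} [SeminormedAddCommGroup E] {F : Type*} [SeminormedAddCommGroup F]
    (Λ : Set E) (c : E → F) : Prop :=
  ∃ (C : ℝ) (N : ℕ), ∀ R : ℝ, 1 ≤ R →
    ∑ᶠ x ∈ Λ ∩ Metric.closedBall (0 : E) R, ‖c x‖ ≤ C * R ^ N

/-- Unfolding lemma for `HasTemperedMasses` (eq. (2) in normal form). [cite: OlevskiiUlanovskii2021, §2 eq. (2)] -/
theorem hasTemperedMasses_iff {E : Type*} [SeminormedAddCommGroup E] {F : Type*}
    [SeminormedAddCommGroup F] (Λ : Set E) (c : E → F) :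
    HasTemperedMasses Λ c ↔ ∃ (C : ℝ) (N : ℕ), ∀ R : ℝ, 1 ≤ R →
      ∑ᶠ x ∈ Λ ∩ Metric.closedBall (0 : E) R, ‖c x‖ ≤ C * R ^ N :=
  Iff.rfl

/-- The constant in (2) can be taken nonnegative. [cite: OlevskiiUlanovskii2021, §2 eq. (2)] -/
theorem HasTemperedMasses.exists_nonneg {E : Type*} [SeminormedAddCommGroup E] {F : Type*}
    [SeminormedAddCommGroup F] {Λ : Set E} {c : E → F} (h : HasTemperedMasses Λ c) :
    ∃ (C : ℝ) (N : ℕ), 0 ≤ C ∧ ∀ R : ℝ, 1 ≤ R →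
      ∑ᶠ x ∈ Λ ∩ Metric.closedBall (0 : E) R, ‖c x‖ ≤ C * R ^ N := by
  obtain ⟨C, N, hC⟩ := h
  refine ⟨C, N, ?_, hC⟩
  have h1 := hC 1 le_rfl
  rw [one_pow, mul_one] at h1
  exact (finsum_nonneg fun x => finsum_nonneg fun _ => norm_nonneg (c x)).trans h1

/-! ### Crystalline measures and Fourier quasicrystals -/

section Defs

variable {V : Type*} [NormedAddCommGroup V] [InnerProductSpace ℝ V] [FiniteDimensional ℝ V]
  [MeasurableSpace V] [BorelSpace V]

/-- **Crystalline measure** (Meyer; Olevskii–Ulanovskii 2020, §1): the atomic measure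
`μ = Σ_{λ∈Λ} c_λ δ_λ` with locally finite `Λ` is a tempered distribution whose distributional Fourier
transform is the atomic measure `μ̂ = Σ_{s∈S} a_s δ_s` with locally finite `S`.  Rendered through
Mathlib's tempered distributions `𝓢'(V, ℂ)`: some `T : 𝓢'(V, ℂ)` restricts, on compactly supported test
functions, to the Radon measure `Σ c_λ δ_λ`, and its distributional Fourier transform `𝓕 T`
(`⟪𝓕T, φ⟫ = ⟪T, 𝓕φ⟫`) restricts, on compactly supported test functions, to `Σ a_s δ_s` (both sums are
finite there).  `T` is unique when it exists (density of `C_c^∞` in `𝓢`). Only the values of `c` on `Λ`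
and of `a` on `S` matter. [cite: OlevskiiUlanovskii2021, §1 p.1207] -/
structure IsCrystallineMeasure (Λ : Set V) (c : V → ℂ) (S : Set V) (a : V → ℂ) : Prop where
  locallyFinite_support : IsLocallyFiniteSet Λ
  locallyFinite_spectrum : IsLocallyFiniteSet S
  exists_temperedDistribution :
    ∃ T : 𝓢'(V, ℂ),
      (∀ φ : 𝓢(V, ℂ), HasCompactSupport φ → T φ = ∑' x : Λ, c x * φ x) ∧
      (∀ φ : 𝓢(V, ℂ), HasCompactSupport φ → 𝓕 T φ = ∑' s : S, a s * φ s)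

/-- **Fourier quasicrystal** (Olevskii–Ulanovskii 2020, §1): a crystalline measure
`μ = Σ_{λ∈Λ} c_λ δ_λ`, `μ̂ = Σ_{s∈S} a_s δ_s` such that `|μ|` and `|μ̂|` are also tempered.  Rendered
elementarily (equivalently, see the module docstring): `Λ` and `S` are locally finite, the masses `c` on
`Λ` and `a` on `S` are tempered (`HasTemperedMasses`, eq. (2)), and `μ̂ = Σ a_s δ_s` holds as the
distributional identity `⟪μ, 𝓕φ⟫ = ⟪μ̂, φ⟫` for every Schwartz function `φ`,
`Σ_{λ∈Λ} c_λ (𝓕φ)(λ) = Σ_{s∈S} a_s φ(s)` (`𝓕` = Mathlib's Fourier transform, the paper's normalisation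
`e^{-2πitx}`; both series converge absolutely, `HasTemperedMasses.summable_mul_schwartz`). Only the values
of `c` on `Λ` and of `a` on `S` matter. [cite: OlevskiiUlanovskii2021, §1 p.1207] -/
structure IsFourierQuasicrystal (Λ : Set V) (c : V → ℂ) (S : Set V) (a : V → ℂ) : Prop where
  locallyFinite_support : IsLocallyFiniteSet Λ
  locallyFinite_spectrum : IsLocallyFiniteSet S
  temperedMasses_support : HasTemperedMasses Λ c
  temperedMasses_spectrum : HasTemperedMasses S a
  duality : ∀ φ : 𝓢(V, ℂ), ∑' x : Λ, c x * 𝓕 φ x = ∑' s : S, a s * φ s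

end Defs

/-! ### Tempered masses pair absolutely with Schwartz functions

The estimate behind "both series converge absolutely" (used tacitly throughout the paper, e.g. p.1208
"The series above converges absolutely due to (2)"): if `Σ_{‖λ‖≤R} ‖c_λ‖ ≤ C R^N` for `R ≥ 1`, then for a
Schwartz function `φ`, summing over the shells `n ≤ ‖λ‖ < n + 1` and using
`(1 + ‖x‖)^{N+2} ‖φ(x)‖ ≤ 2^{N+2} p_{N+2,0}(φ)`,
`Σ_{λ∈Λ} ‖c_λ φ(λ)‖ ≤ Σ_n C (n+1)^N · 2^{N+2} p(φ) (n+1)^{-(N+2)} = 2^{N+2} C (Σ_n (n+1)^{-2}) p(φ)`. -/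

section Summability

variable {E : Type*} [NormedAddCommGroup E] [NormedSpace ℝ E]

omit [NormedSpace ℝ E] in
/-- A finite partial sum of masses inside the ball of radius `R` is at most the total mass there.
[folklore] -/
private theorem sum_norm_le_finsum {Λ : Set E} (hΛ : IsLocallyFiniteSet Λ) (c : E → ℂ)
    (F : Finset Λ) (R : ℝ) (hF : ∀ x ∈ F, ‖(x : E)‖ ≤ R) :
    ∑ x ∈ F, ‖c x‖ ≤ ∑ᶠ x ∈ Λ ∩ Metric.closedBall (0 : E) R, ‖c x‖ := by
  have hs : (Λ ∩ Metric.closedBall (0 : E) R).Finite := hΛ 0 R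
  rw [finsum_mem_eq_finite_toFinset_sum _ hs]
  have : ∑ x ∈ F, ‖c x‖ = ∑ x ∈ F.map (Function.Embedding.subtype _), ‖c x‖ := by
    rw [Finset.sum_map]
    rfl
  rw [this]
  apply Finset.sum_le_sum_of_subset_of_nonneg
  · intro y hy
    rw [Finset.mem_map] at hy
    obtain ⟨x, hx, rfl⟩ := hy
    rw [Set.Finite.mem_toFinset]
    refine ⟨x.2, ?_⟩
    rw [Metric.mem_closedBall, dist_zero_right]
    exact hF x hx
  · intro _ _ _
    exact norm_nonneg _

/-- **Key estimate.** For tempered masses on a locally finite set, the finite partial sums of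
`Σ_{λ∈Λ} |c_λ φ(λ)|` are bounded by a fixed finite family of Schwartz seminorms of `φ` (the estimate
behind p.1208 "The series above converges absolutely due to (2)" and §1 "`μ` is a tempered
distribution"). [cite: OlevskiiUlanovskii2021, §2 p.1208] -/
theorem HasTemperedMasses.exists_sum_norm_mul_le {Λ : Set E} {c : E → ℂ}
    (hc : HasTemperedMasses Λ c) (hΛ : IsLocallyFiniteSet Λ) :
    ∃ (N : ℕ) (B : ℝ), 0 ≤ B ∧ ∀ (φ : 𝓢(E, ℂ)) (F : Finset Λ),
      ∑ x ∈ F, ‖c x * φ x‖ ≤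
        B * (Finset.Iic (N + 2, 0)).sup (fun m => SchwartzMap.seminorm ℂ m.1 m.2) φ := by
  obtain ⟨C, N, hC0, hC⟩ := hc.exists_nonneg
  have hSsum : Summable (fun n : ℕ => (((n : ℝ) + 1) ^ 2)⁻¹) := by
    have := (summable_nat_add_iff 1).2 (Real.summable_nat_pow_inv.2 one_lt_two)
    simpa [Nat.cast_add, Nat.cast_one] using this
  set S : ℝ := ∑' n : ℕ, (((n : ℝ) + 1) ^ 2)⁻¹ with hS_def
  have hS0 : 0 ≤ S := tsum_nonneg fun n => by positivity
  refine ⟨N, 2 ^ (N + 2) * C * S, by positivity, fun φ F => ?_⟩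
  set M : ℝ := 2 ^ (N + 2) * (Finset.Iic (N + 2, 0)).sup (fun m => SchwartzMap.seminorm ℂ m.1 m.2) φ
    with hM_def
  have hM0 : 0 ≤ M := mul_nonneg (by positivity) (apply_nonneg _ _)
  have hdecay : ∀ x : E, (1 + ‖x‖) ^ (N + 2) * ‖φ x‖ ≤ M := by
    intro x
    have := SchwartzMap.one_add_le_sup_seminorm_apply (𝕜 := ℂ) (m := (N + 2, 0)) le_rfl le_rfl φ x
    simpa [norm_iteratedFDeriv_zero] using this
  -- shell index
  let g : Λ → ℕ := fun x => ⌊‖(x : E)‖⌋₊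
  have hfiber : ∀ n : ℕ,
      ∑ x ∈ F with g x = n, ‖c x * φ x‖ ≤ M * C * (((n : ℝ) + 1) ^ 2)⁻¹ := by
    intro n
    have hφ : ∀ x ∈ F.filter (fun x => g x = n),
        ‖c x * φ x‖ ≤ ‖c (x : E)‖ * (M / ((n : ℝ) + 1) ^ (N + 2)) := by
      intro x hx
      rw [Finset.mem_filter] at hx
      rw [norm_mul]
      gcongr
      have hgx : ⌊‖(x : E)‖⌋₊ = n := hx.2
      have hn : (n : ℝ) ≤ ‖(x : E)‖ := by
        have := Nat.floor_le (norm_nonneg (x : E))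
        rw [hgx] at this
        exact this
      rw [le_div_iff₀ (by positivity)]
      have hle : ((n : ℝ) + 1) ^ (N + 2) ≤ (1 + ‖(x : E)‖) ^ (N + 2) :=
        pow_le_pow_left₀ (by positivity) (by linarith) _
      calc ‖φ x‖ * ((n : ℝ) + 1) ^ (N + 2) ≤ ‖φ x‖ * (1 + ‖(x : E)‖) ^ (N + 2) :=
            mul_le_mul_of_nonneg_left hle (norm_nonneg _)
        _ = (1 + ‖(x : E)‖) ^ (N + 2) * ‖φ x‖ := mul_comm _ _
        _ ≤ M := hdecay x
    have hmass : ∑ x ∈ F with g x = n, ‖c (x : E)‖ ≤ C * ((n : ℝ) + 1) ^ N := by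
      refine (sum_norm_le_finsum hΛ c _ ((n : ℝ) + 1) ?_).trans (hC _ (by linarith [n.cast_nonneg (α := ℝ)]))
      intro x hx
      rw [Finset.mem_filter] at hx
      have hgx : ⌊‖(x : E)‖⌋₊ = n := hx.2
      have := Nat.lt_floor_add_one ‖(x : E)‖
      rw [hgx] at this
      exact this.le
    calc ∑ x ∈ F with g x = n, ‖c x * φ x‖
        ≤ ∑ x ∈ F with g x = n, ‖c (x : E)‖ * (M / ((n : ℝ) + 1) ^ (N + 2)) :=
          Finset.sum_le_sum hφ
      _ = (∑ x ∈ F with g x = n, ‖c (x : E)‖) * (M / ((n : ℝ) + 1) ^ (N + 2)) := by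
          rw [Finset.sum_mul]
      _ ≤ (C * ((n : ℝ) + 1) ^ N) * (M / ((n : ℝ) + 1) ^ (N + 2)) := by gcongr
      _ = M * C * (((n : ℝ) + 1) ^ 2)⁻¹ := by
          have : ((n : ℝ) + 1) ≠ 0 := by positivity
          field_simp
          ring
  have hmaps : ∀ x ∈ F, g x ∈ F.image g := fun x hx => Finset.mem_image_of_mem g hx
  calc ∑ x ∈ F, ‖c x * φ x‖
      = ∑ n ∈ F.image g, ∑ x ∈ F with g x = n, ‖c x * φ x‖ :=
        (Finset.sum_fiberwise_of_maps_to hmaps _).symm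
    _ ≤ ∑ n ∈ F.image g, M * C * (((n : ℝ) + 1) ^ 2)⁻¹ := Finset.sum_le_sum fun n _ => hfiber n
    _ = M * C * ∑ n ∈ F.image g, (((n : ℝ) + 1) ^ 2)⁻¹ := by rw [Finset.mul_sum]
    _ ≤ M * C * S := by
        gcongr
        exact hSsum.sum_le_tsum _ (fun n _ => by positivity)
    _ = 2 ^ (N + 2) * C * S *
          (Finset.Iic (N + 2, 0)).sup (fun m => SchwartzMap.seminorm ℂ m.1 m.2) φ := by
        rw [hM_def]; ring

/-- Tempered masses pair absolutely with Schwartz functions: `Σ_{λ∈Λ} |c_λ φ(λ)| < ∞` (p.1208 "The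
series above converges absolutely due to (2)"). [cite: OlevskiiUlanovskii2021, §2 p.1208] -/
theorem HasTemperedMasses.summable_norm_mul_schwartz {Λ : Set E} {c : E → ℂ}
    (hc : HasTemperedMasses Λ c) (hΛ : IsLocallyFiniteSet Λ) (φ : 𝓢(E, ℂ)) :
    Summable (fun x : Λ => ‖c x * φ x‖) := by
  obtain ⟨N, B, _, hB⟩ := hc.exists_sum_norm_mul_le hΛ
  exact summable_of_sum_le (fun _ => norm_nonneg _) (hB φ)

/-- Tempered masses pair (absolutely, hence unconditionally) with Schwartz functions.
[cite: OlevskiiUlanovskii2021, §2 p.1208] -/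
theorem HasTemperedMasses.summable_mul_schwartz {Λ : Set E} {c : E → ℂ}
    (hc : HasTemperedMasses Λ c) (hΛ : IsLocallyFiniteSet Λ) (φ : 𝓢(E, ℂ)) :
    Summable (fun x : Λ => c x * φ x) :=
  (hc.summable_norm_mul_schwartz hΛ φ).of_norm

/-- Continuity estimate: `|Σ_{λ∈Λ} c_λ φ(λ)| ≤ B · max_{k ≤ N+2} p_{k,0}(φ)` (so `μ` and `|μ|` are
tempered distributions, §1). [cite: OlevskiiUlanovskii2021, §1 p.1207] -/
theorem HasTemperedMasses.exists_norm_tsum_mul_le {Λ : Set E} {c : E → ℂ}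
    (hc : HasTemperedMasses Λ c) (hΛ : IsLocallyFiniteSet Λ) :
    ∃ (N : ℕ) (B : ℝ), 0 ≤ B ∧ ∀ φ : 𝓢(E, ℂ),
      ‖∑' x : Λ, c x * φ x‖ ≤
        B * (Finset.Iic (N + 2, 0)).sup (fun m => SchwartzMap.seminorm ℂ m.1 m.2) φ := by
  obtain ⟨N, B, hB0, hB⟩ := hc.exists_sum_norm_mul_le hΛ
  refine ⟨N, B, hB0, fun φ => ?_⟩
  calc ‖∑' x : Λ, c x * φ x‖ ≤ ∑' x : Λ, ‖c x * φ x‖ :=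
        norm_tsum_le_tsum_norm (summable_of_sum_le (fun _ => norm_nonneg _) (hB φ))
    _ ≤ _ := Real.tsum_le_of_sum_le (fun _ => norm_nonneg _) (hB φ)

/-- The **tempered distribution** `φ ↦ Σ_{λ∈Λ} c_λ φ(λ)` defined by tempered masses `c` on a locally
finite set `Λ` (this is "`μ = Σ c_λ δ_λ` is a tempered distribution, and so is `|μ|`", §1), as an element
of Mathlib's `𝓢'(E, ℂ)`. [cite: OlevskiiUlanovskii2021, §1 p.1207] -/
def HasTemperedMasses.temperedDistribution {Λ : Set E} {c : E → ℂ}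
    (hc : HasTemperedMasses Λ c) (hΛ : IsLocallyFiniteSet Λ) : 𝓢'(E, ℂ) :=
  ContinuousLinearMap.toPointwiseConvergenceCLM _ _ _ _ <|
    SchwartzMap.mkCLMtoNormedSpace (𝕜 := ℂ) (σ := RingHom.id ℂ)
      (fun φ : 𝓢(E, ℂ) => ∑' x : Λ, c x * φ x)
      (fun φ ψ => by
        simp only [add_apply, mul_add]
        exact (hc.summable_mul_schwartz hΛ φ).tsum_add (hc.summable_mul_schwartz hΛ ψ))
      (fun a φ => by
        simp only [smul_apply, smul_eq_mul, RingHom.id_apply, mul_left_comm _ a]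
        exact tsum_mul_left)
      (by
        obtain ⟨N, B, hB0, hB⟩ := hc.exists_norm_tsum_mul_le hΛ
        exact ⟨Finset.Iic (N + 2, 0), B, hB0, hB⟩)

/-- `⟨μ, φ⟩ = Σ_{λ∈Λ} c_λ φ(λ)`. [cite: OlevskiiUlanovskii2021, §1 p.1207] -/
@[simp]
theorem HasTemperedMasses.temperedDistribution_apply {Λ : Set E} {c : E → ℂ}
    (hc : HasTemperedMasses Λ c) (hΛ : IsLocallyFiniteSet Λ) (φ : 𝓢(E, ℂ)) :
    hc.temperedDistribution hΛ φ = ∑' x : Λ, c x * φ x :=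
  rfl

end Summability

section FQ

variable {V : Type*} [NormedAddCommGroup V] [InnerProductSpace ℝ V] [FiniteDimensional ℝ V]
  [MeasurableSpace V] [BorelSpace V]
variable {Λ S : Set V} {c a : V → ℂ}

/-- For an FQ, `Σ_{λ∈Λ} c_λ φ(λ)` converges (absolutely) for every Schwartz `φ`.
[cite: OlevskiiUlanovskii2021, §1 p.1207] -/
theorem IsFourierQuasicrystal.summable_support (h : IsFourierQuasicrystal Λ c S a) (φ : 𝓢(V, ℂ)) :
    Summable (fun x : Λ => c x * φ x) :=
  h.temperedMasses_support.summable_mul_schwartz h.locallyFinite_support φ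

/-- For an FQ, `Σ_{s∈S} a_s φ(s)` converges (absolutely) for every Schwartz `φ`.
[cite: OlevskiiUlanovskii2021, §1 p.1207] -/
theorem IsFourierQuasicrystal.summable_spectrum (h : IsFourierQuasicrystal Λ c S a) (φ : 𝓢(V, ℂ)) :
    Summable (fun s : S => a s * φ s) :=
  h.temperedMasses_spectrum.summable_mul_schwartz h.locallyFinite_spectrum φ

/-- The tempered distribution `μ = Σ_{λ∈Λ} c_λ δ_λ` of a Fourier quasicrystal (§1: an FQ is in
particular "an atomic measure `μ` which is a tempered distribution"). [cite: OlevskiiUlanovskii2021, §1 p.1207] -/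
def IsFourierQuasicrystal.temperedDistribution (h : IsFourierQuasicrystal Λ c S a) : 𝓢'(V, ℂ) :=
  h.temperedMasses_support.temperedDistribution h.locallyFinite_support

/-- `⟨μ, φ⟩ = Σ_{λ∈Λ} c_λ φ(λ)` for an FQ. [cite: OlevskiiUlanovskii2021, §1 p.1207] -/
@[simp]
theorem IsFourierQuasicrystal.temperedDistribution_apply (h : IsFourierQuasicrystal Λ c S a)
    (φ : 𝓢(V, ℂ)) : h.temperedDistribution φ = ∑' x : Λ, c x * φ x :=
  rfl

/-- `μ̂ = Σ_{s∈S} a_s δ_s` as an identity of tempered distributions: the distributional Fourier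
transform of `μ` is the tempered distribution of the spectral masses (§1 "whose distributional Fourier
transform is also an atomic measure"). [cite: OlevskiiUlanovskii2021, §1 p.1207] -/
theorem IsFourierQuasicrystal.fourier_temperedDistribution (h : IsFourierQuasicrystal Λ c S a) :
    𝓕 h.temperedDistribution =
      h.temperedMasses_spectrum.temperedDistribution h.locallyFinite_spectrum := by
  ext φ
  rw [TemperedDistribution.fourier_apply, h.temperedDistribution_apply,
    HasTemperedMasses.temperedDistribution_apply]
  exact h.duality φ

/-- `⟨μ̂, φ⟩ = Σ_{s∈S} a_s φ(s)` for an FQ. [cite: OlevskiiUlanovskii2021, §1 p.1207] -/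
theorem IsFourierQuasicrystal.fourier_temperedDistribution_apply (h : IsFourierQuasicrystal Λ c S a)
    (φ : 𝓢(V, ℂ)) : 𝓕 h.temperedDistribution φ = ∑' s : S, a s * φ s := by
  rw [h.fourier_temperedDistribution, HasTemperedMasses.temperedDistribution_apply]

/-- **A Fourier quasicrystal is a crystalline measure** (§1: an FQ is a crystalline measure with
`|μ|`, `|μ̂|` tempered; here: the elementary rendering implies the distributional one). [cite: OlevskiiUlanovskii2021, §1 p.1207] -/
theorem IsFourierQuasicrystal.isCrystallineMeasure (h : IsFourierQuasicrystal Λ c S a) :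
    IsCrystallineMeasure Λ c S a where
  locallyFinite_support := h.locallyFinite_support
  locallyFinite_spectrum := h.locallyFinite_spectrum
  exists_temperedDistribution :=
    ⟨h.temperedDistribution, fun φ _ => h.temperedDistribution_apply φ,
      fun φ _ => h.fourier_temperedDistribution_apply φ⟩

/-- The duality with the roles of `μ` and `μ̂` exchanged up to a reflection:
`Σ_{s∈S} a_s (𝓕φ)(s) = Σ_{λ∈Λ} c_λ φ(-λ)` (apply the defining identity to `𝓕φ` and use `𝓕𝓕φ = φ(-·)`).
[cite: OlevskiiUlanovskii2021, §1 p.1207] -/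
theorem IsFourierQuasicrystal.duality_symm (h : IsFourierQuasicrystal Λ c S a) (φ : 𝓢(V, ℂ)) :
    ∑' s : S, a s * 𝓕 φ s = ∑' x : Λ, c x * φ (-x) := by
  rw [← h.duality (𝓕 φ)]
  refine tsum_congr fun x => ?_
  congr 1
  have h1 : (𝓕⁻ (𝓕 φ) : 𝓢(V, ℂ)) = φ := FourierTransform.fourierInv_fourier_eq φ
  conv_rhs => rw [← h1]
  rw [SchwartzMap.fourierInv_coe, Real.fourierInv_eq_fourier_neg, neg_neg, ← SchwartzMap.fourier_coe]

end FQ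

/-! ### The Dirac comb `Σ_{n∈ℤ} δ_n` is a Fourier quasicrystal with `μ̂ = μ` (Poisson summation) -/

section DiracComb

/-- `ℤ ⊂ ℝ` is locally finite (support and spectrum of the Dirac comb, §1). [cite: OlevskiiUlanovskii2021, §1 p.1207] -/
theorem isLocallyFiniteSet_range_intCast :
    IsLocallyFiniteSet (Set.range (Int.cast : ℤ → ℝ)) := by
  intro x r
  rw [← Set.image_preimage_eq_range_inter]
  exact ((tendsto_cofinite_cocompact_iff.1 Int.tendsto_coe_cofinite) _
    (isCompact_closedBall x r)).image _

/-- `#(ℤ ∩ [-R, R]) ≤ 2R + 1 ≤ 3R` for `R ≥ 1`: unit masses on `ℤ` are tempered (Dirac comb, §1).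
[cite: OlevskiiUlanovskii2021, §1 p.1207] -/
theorem finsum_mem_range_intCast_closedBall_le {R : ℝ} (hR : 1 ≤ R) :
    ∑ᶠ x ∈ Set.range (Int.cast : ℤ → ℝ) ∩ Metric.closedBall (0 : ℝ) R, ‖(1 : ℂ)‖ ≤ 3 * R := by
  have hs := isLocallyFiniteSet_range_intCast 0 R
  rw [finsum_mem_eq_finite_toFinset_sum _ hs]
  simp only [norm_one, Finset.sum_const, nsmul_eq_mul, mul_one]
  have h0 : 0 ≤ ⌊R⌋ := Int.floor_nonneg.2 (by linarith)
  have hsub : hs.toFinset ⊆ (Finset.Icc (-⌊R⌋) ⌊R⌋).image (Int.cast : ℤ → ℝ) := by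
    intro y hy
    rw [Set.Finite.mem_toFinset] at hy
    obtain ⟨⟨n, rfl⟩, hn⟩ := hy
    rw [Metric.mem_closedBall, dist_zero_right, Real.norm_eq_abs, abs_le] at hn
    rw [Finset.mem_image]
    refine ⟨n, Finset.mem_Icc.2 ⟨?_, Int.le_floor.2 hn.2⟩, rfl⟩
    have : -n ≤ ⌊R⌋ := Int.le_floor.2 (by push_cast; linarith [hn.1])
    linarith
  calc (hs.toFinset.card : ℝ)
      ≤ ((Finset.Icc (-⌊R⌋) ⌊R⌋).image (Int.cast : ℤ → ℝ)).card := by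
        exact_mod_cast Finset.card_le_card hsub
    _ ≤ (Finset.Icc (-⌊R⌋) ⌊R⌋).card := by exact_mod_cast Finset.card_image_le
    _ = (((⌊R⌋ + 1 - -⌊R⌋).toNat : ℤ) : ℝ) := by rw [Int.card_Icc, Int.cast_natCast]
    _ = 2 * (⌊R⌋ : ℝ) + 1 := by
        rw [Int.toNat_of_nonneg (by linarith)]
        push_cast
        ring
    _ ≤ 2 * R + 1 := by gcongr; exact Int.floor_le R
    _ ≤ 3 * R := by linarith

/-- **The Dirac comb is a Fourier quasicrystal**, `μ = Σ_{n∈ℤ} δ_n = μ̂` (Olevskii–Ulanovskii 2020, §1: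
"A classical example of an FQ is a Dirac comb … which satisfies `μ̂ = μ`"); the duality is Poisson's
summation formula for Schwartz functions (Mathlib `SchwartzMap.tsum_eq_tsum_fourier`).
[cite: OlevskiiUlanovskii2021, §1 p.1207] -/
theorem isFourierQuasicrystal_diracComb :
    IsFourierQuasicrystal (Set.range (Int.cast : ℤ → ℝ)) (fun _ => 1)
      (Set.range (Int.cast : ℤ → ℝ)) (fun _ => 1) where
  locallyFinite_support := isLocallyFiniteSet_range_intCast
  locallyFinite_spectrum := isLocallyFiniteSet_range_intCast
  temperedMasses_support := ⟨3, 1, fun R hR => by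
    simpa using finsum_mem_range_intCast_closedBall_le hR⟩
  temperedMasses_spectrum := ⟨3, 1, fun R hR => by
    simpa using finsum_mem_range_intCast_closedBall_le hR⟩
  duality φ := by
    simp only [one_mul]
    have h1 : ∑' x : Set.range (Int.cast : ℤ → ℝ), 𝓕 φ x = ∑' n : ℤ, 𝓕 φ n :=
      tsum_range (fun x : ℝ => 𝓕 φ x) Int.cast_injective
    have h2 : ∑' x : Set.range (Int.cast : ℤ → ℝ), φ x = ∑' n : ℤ, φ n :=
      tsum_range (fun x : ℝ => φ x) Int.cast_injective
    rw [h1, h2]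
    have := SchwartzMap.tsum_eq_tsum_fourier φ 0
    simp only [zero_add, QuotientAddGroup.mk_zero, fourier_eval_zero, mul_one] at this
    exact this.symm

end DiracComb

/-! ### Exponential polynomials, uniformly discrete sets -/

/-- The **exponential polynomial with imaginary frequencies** `p(z) = Σ_{k<n} b_k e^{i γ_k z}`
(`b_k ∈ ℂ`, `γ_k ∈ ℝ`), as an entire function of `z ∈ ℂ` (Olevskii–Ulanovskii 2020, Theorem 1).
[cite: OlevskiiUlanovskii2021, Thm 1] -/
def expPoly {n : ℕ} (b : Fin n → ℂ) (γ : Fin n → ℝ) (z : ℂ) : ℂ :=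
  ∑ k, b k * Complex.exp (Complex.I * (γ k : ℂ) * z)

/-- Unfolding lemma for `expPoly`. [cite: OlevskiiUlanovskii2021, Thm 1] -/
theorem expPoly_apply {n : ℕ} (b : Fin n → ℂ) (γ : Fin n → ℝ) (z : ℂ) :
    expPoly b γ z = ∑ k, b k * Complex.exp (Complex.I * (γ k : ℂ) * z) :=
  rfl

/-- An exponential polynomial is an entire function. [cite: OlevskiiUlanovskii2021, Thm 1] -/
theorem differentiable_expPoly {n : ℕ} (b : Fin n → ℂ) (γ : Fin n → ℝ) :
    Differentiable ℂ (expPoly b γ) := by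
  unfold expPoly
  fun_prop

/-- `p` has **real simple zeros**: every complex zero of the entire function `p` is real and simple
(Theorem 1: "an exponential polynomial … with real simple zeros"). [cite: OlevskiiUlanovskii2021, Thm 1] -/
def HasRealSimpleZeros (p : ℂ → ℂ) : Prop :=
  ∀ z : ℂ, p z = 0 → z.im = 0 ∧ deriv p z ≠ 0

/-- `p` has **real zeros**: every complex zero of `p` is real, multiplicities allowed (Remark 1.1:
"(not necessarily simple) real zeros"). [cite: OlevskiiUlanovskii2021, Remark 1.1] -/
def HasRealZeros (p : ℂ → ℂ) : Prop :=
  ∀ z : ℂ, p z = 0 → z.im = 0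

/-- Real simple zeros are real zeros. [cite: OlevskiiUlanovskii2021, Remark 1.1] -/
theorem HasRealSimpleZeros.hasRealZeros {p : ℂ → ℂ} (h : HasRealSimpleZeros p) : HasRealZeros p :=
  fun z hz => (h z hz).1

/-- The **real zero set** `{x ∈ ℝ | p x = 0}` of `p : ℂ → ℂ` (Theorem 1: "such that `Λ` is the zero
set of `p`"). [cite: OlevskiiUlanovskii2021, Thm 1] -/
def realZeroSet (p : ℂ → ℂ) : Set ℝ :=
  {x : ℝ | p x = 0}

/-- Membership in the real zero set. [cite: OlevskiiUlanovskii2021, Thm 1] -/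
theorem mem_realZeroSet {p : ℂ → ℂ} {x : ℝ} : x ∈ realZeroSet p ↔ p x = 0 :=
  Iff.rfl

/-- `Λ ⊂ ℝ` is **relatively uniformly discrete**: a union of finitely many uniformly discrete sets
(Olevskii–Ulanovskii 2020, §2 p.1208; "uniformly discrete" is the tree's
`Literature.Geometry.DiscreteGeometry.IsUniformlyDiscrete`, distinct points at distance `≥ r > 0`).
[cite: OlevskiiUlanovskii2021, §2 p.1208] -/
def IsRelativelyUniformlyDiscrete {X : Type*} [MetricSpace X] (Λ : Set X) : Prop :=
  ∃ (k : ℕ) (P : Fin k → Set X), (∀ i, IsUniformlyDiscrete (P i)) ∧ Λ = ⋃ i, P i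

/-- A uniformly discrete set is relatively uniformly discrete (one piece).
[cite: OlevskiiUlanovskii2021, §2 p.1208] -/
theorem IsUniformlyDiscrete.isRelativelyUniformlyDiscrete {X : Type*} [MetricSpace X] {Λ : Set X}
    (h : IsUniformlyDiscrete Λ) : IsRelativelyUniformlyDiscrete Λ :=
  ⟨1, fun _ => Λ, fun _ => h, (Set.iUnion_const Λ).symm⟩

/-! ### The results of Olevskii–Ulanovskii 2020 as named facts -/

/-- **Olevskii–Ulanovskii 2020, Proposition 1** (p.1208). Let `μ` be a positive measure on `ℝ` which
is a tempered distribution, such that its distributional Fourier transform `μ̂` is a measure satisfying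
(2) `∫_{(-R,R)} d|μ̂| = O(R^m)` for some `m > 0` (i.e. `|μ̂|` is tempered). Then there exists `C` such
that `μ(a,b) ≤ C (1 + b − a)` for all `a < b`.  Rendering: `μ : Measure ℝ` of temperate growth; `μ̂`
in polar form `u · ρ` with `ρ : Measure ℝ` of temperate growth and a measurable density `‖u‖ ≤ 1`,
the identity `μ̂ = u ρ` meaning `∫ 𝓕φ dμ = ∫ φ u dρ` for every Schwartz `φ`.
[cite: OlevskiiUlanovskii2021, Prop 1] -/
def OU2020_prop_1 : Prop :=
  ∀ (μ ρ : Measure ℝ) (u : ℝ → ℂ), μ.HasTemperateGrowth → ρ.HasTemperateGrowth →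
    Measurable u → (∀ t, ‖u t‖ ≤ 1) →
    (∀ φ : 𝓢(ℝ, ℂ), ∫ x, 𝓕 φ x ∂μ = ∫ t, u t * φ t ∂ρ) →
    ∃ C : ℝ, ∀ a b : ℝ, a < b → μ (Set.Ioo a b) ≤ ENNReal.ofReal (C * (1 + (b - a)))

/-- **Olevskii–Ulanovskii 2020, Corollary 1** (p.1208). Let `μ = Σ_{λ∈Λ} δ_λ` (unit masses on a
locally finite `Λ ⊂ ℝ`, `μ` a tempered distribution) be a measure whose distributional Fourier transform
is a measure satisfying (2). Then `Λ` is relatively uniformly discrete.  Rendering as for Proposition 1: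
`μ` is the atomic datum `(Λ, 1)` with tempered masses, `μ̂ = u · ρ` in polar form (`ρ : Measure ℝ` of
temperate growth, measurable density `‖u‖ ≤ 1`), the identity `μ̂ = u ρ` tested on Schwartz functions,
`Σ_{λ∈Λ} (𝓕φ)(λ) = ∫ φ u dρ`. [cite: OlevskiiUlanovskii2021, Cor 1] -/
def OU2020_cor_1 : Prop :=
  ∀ (Λ : Set ℝ) (ρ : Measure ℝ) (u : ℝ → ℂ), IsLocallyFiniteSet Λ →
    HasTemperedMasses Λ (fun _ => (1 : ℂ)) → ρ.HasTemperateGrowth → Measurable u → (∀ t, ‖u t‖ ≤ 1) →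
    (∀ φ : 𝓢(ℝ, ℂ), ∑' x : Λ, 𝓕 φ x = ∫ t, u t * φ t ∂ρ) →
    IsRelativelyUniformlyDiscrete Λ

/-- **Olevskii–Ulanovskii 2020, Theorem 1** (p.1207). Let `μ = Σ_{λ∈Λ} δ_λ` be a Fourier quasicrystal
with unit masses. Then there is an exponential polynomial `p(x) = Σ_{k=1}^{n} b_k e^{iγ_k x}`
(`n ∈ ℕ, b_k ∈ ℂ, γ_k ∈ ℝ`) with real simple zeros such that `Λ` is the zero set of `p`.
[cite: OlevskiiUlanovskii2021, Thm 1] -/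
def OU2020_thm_1 : Prop :=
  ∀ (Λ S : Set ℝ) (a : ℝ → ℂ), IsFourierQuasicrystal Λ (fun _ => 1) S a →
    ∃ (n : ℕ) (b : Fin n → ℂ) (γ : Fin n → ℝ),
      HasRealSimpleZeros (expPoly b γ) ∧ Λ = realZeroSet (expPoly b γ)

/-- **Olevskii–Ulanovskii 2020, Remark 1.1** (p.1209; printed as a remark: "Some minor changes in the
proof of Theorem 1 allow one to prove the following extension of Theorem 1 to measures with integer
masses"). Let `μ = Σ_{λ∈Λ} c_λ δ_λ` with `c_λ ∈ ℕ` (positive integer masses at the points of the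
support `Λ`) be a Fourier quasicrystal. Then there is an exponential polynomial `p` with imaginary
frequencies and (not necessarily simple) real zeros such that `Λ` is the zero set of `p`.  (The printed
statement identifies the zero *set* only; that the multiplicity of the zero `λ` equals `c_λ` is what the
proof gives but is not printed, and is not asserted here.) [cite: OlevskiiUlanovskii2021, Remark 1.1] -/
def OU2020_rem_1_1 : Prop :=
  ∀ (Λ S : Set ℝ) (c a : ℝ → ℂ), (∀ x ∈ Λ, ∃ m : ℕ, 1 ≤ m ∧ c x = m) →
    IsFourierQuasicrystal Λ c S a →
    ∃ (n : ℕ) (b : Fin n → ℂ) (γ : Fin n → ℝ),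
      HasRealZeros (expPoly b γ) ∧ Λ = realZeroSet (expPoly b γ)

/-- Remark 1.1 specialised to unit masses gives the zero-set half of Theorem 1 (the simplicity of the
zeros is the extra content of Theorem 1). [cite: OlevskiiUlanovskii2021, Remark 1.1] -/
theorem OU2020_rem_1_1.zeroSet_of_unitMasses (h : OU2020_rem_1_1) (Λ S : Set ℝ) (a : ℝ → ℂ)
    (hμ : IsFourierQuasicrystal Λ (fun _ => 1) S a) :
    ∃ (n : ℕ) (b : Fin n → ℂ) (γ : Fin n → ℝ),
      HasRealZeros (expPoly b γ) ∧ Λ = realZeroSet (expPoly b γ) :=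
  h Λ S (fun _ => 1) a (fun _ _ => ⟨1, le_rfl, by simp⟩) hμ

/-- The zero-set conclusion of Theorem 1 with the simplicity information discarded.
[cite: OlevskiiUlanovskii2021, Thm 1] -/
theorem OU2020_thm_1.zeroSet (h : OU2020_thm_1) (Λ S : Set ℝ) (a : ℝ → ℂ)
    (hμ : IsFourierQuasicrystal Λ (fun _ => 1) S a) :
    ∃ (n : ℕ) (b : Fin n → ℂ) (γ : Fin n → ℝ),
      HasRealZeros (expPoly b γ) ∧ Λ = realZeroSet (expPoly b γ) := by
  obtain ⟨n, b, γ, h1, h2⟩ := h Λ S a hμ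
  exact ⟨n, b, γ, h1.hasRealZeros, h2⟩

/-! ### Proof of Proposition 1 (Olevskii–Ulanovskii 2020, p.1208)

The printed proof tests the duality against `f = g ∗ 1_{(a-1/2, b+1/2)}` for a bump `g`.  We use the
equivalent "sum of translates" test function `f = Σ_{j<m} ψ(· − a − j)` (`m = ⌊b − a⌋ + 1`, `ψ` a smooth
bump equal to `1` on `[0,1]`), which avoids the convolution theorem: `f ≥ 0`, `f ≥ 1` on `(a,b)`, and
`|𝓕⁻f(t)| ≤ m |𝓕⁻ψ(t)|` since translation only modulates the Fourier transform.  Then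
`μ(a,b) ≤ ∫ f dμ = ∫ 𝓕(𝓕⁻f) dμ = ∫ u 𝓕⁻f dρ ≤ m ∫ |𝓕⁻ψ| dρ ≤ (1 + b − a) K`. -/

namespace OU2020Prop1

open scoped ContDiff

/-- A smooth bump on `ℝ`, equal to `1` on `[0, 1]` and supported in `(-1/2, 3/2)`. [folklore] -/
def bump : ContDiffBump (2⁻¹ : ℝ) := ⟨2⁻¹, 1, by norm_num, by norm_num⟩

/-- The bump, complexified, has compact support. [cite: OlevskiiUlanovskii2021, Prop 1 (proof), p.1208] -/
theorem bump_hasCompactSupport : HasCompactSupport (fun x : ℝ => ((bump x : ℝ) : ℂ)) :=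
  bump.hasCompactSupport.comp_left Complex.ofReal_zero

/-- The bump, complexified, is smooth. [cite: OlevskiiUlanovskii2021, Prop 1 (proof), p.1208] -/
theorem bump_contDiff : ContDiff ℝ ∞ (fun x : ℝ => ((bump x : ℝ) : ℂ)) :=
  Complex.ofRealCLM.contDiff.comp bump.contDiff

/-- The bump as a Schwartz function (the `g` of the printed proof, p.1208). [folklore] -/
def ψ : 𝓢(ℝ, ℂ) := bump_hasCompactSupport.toSchwartzMap bump_contDiff

/-- Unfolding lemma. [cite: OlevskiiUlanovskii2021, Prop 1 (proof), p.1208] -/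
theorem ψ_apply (x : ℝ) : ψ x = ((bump x : ℝ) : ℂ) := rfl

/-- `ψ ≥ 0`. [cite: OlevskiiUlanovskii2021, Prop 1 (proof), p.1208] -/
theorem ψ_re_nonneg (x : ℝ) : 0 ≤ (ψ x).re := by
  rw [ψ_apply, Complex.ofReal_re]
  exact bump.nonneg

/-- `ψ = 1` on `[0, 1]`. [cite: OlevskiiUlanovskii2021, Prop 1 (proof), p.1208] -/
theorem ψ_eq_one {x : ℝ} (hx : x ∈ Icc (0 : ℝ) 1) : ψ x = 1 := by
  rw [ψ_apply, bump.one_of_mem_closedBall, Complex.ofReal_one]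
  rw [Metric.mem_closedBall, Real.dist_eq, abs_le]
  show -2⁻¹ ≤ x - 2⁻¹ ∧ x - 2⁻¹ ≤ 2⁻¹
  constructor <;> linarith [hx.1, hx.2]

/-- Pointwise evaluation of a finite sum of Schwartz functions. [cite: OlevskiiUlanovskii2021, Prop 1 (proof), p.1208] -/
theorem schwartz_sum_apply {ι : Type*} (s : Finset ι) (g : ι → 𝓢(ℝ, ℂ)) (x : ℝ) :
    (∑ j ∈ s, g j) x = ∑ j ∈ s, g j x := by
  induction s using Finset.cons_induction with
  | empty => simp
  | cons a s ha ih => rw [Finset.sum_cons, Finset.sum_cons, ← ih]; rfl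

/-- The test function for an interval `(a, b)` with `b - a < m`: `f = Σ_{j<m} ψ(· − a − j)` (the printed
proof uses `g ∗ 1_{(a−1/2,b+1/2)}` instead). [folklore] -/
def fAB (a : ℝ) (m : ℕ) : 𝓢(ℝ, ℂ) :=
  ∑ j ∈ Finset.range m, SchwartzMap.compSubConstCLM ℂ (a + j) ψ

/-- Unfolding lemma. [cite: OlevskiiUlanovskii2021, Prop 1 (proof), p.1208] -/
theorem fAB_apply (a : ℝ) (m : ℕ) (x : ℝ) :
    fAB a m x = ∑ j ∈ Finset.range m, ψ (x - (a + j)) := by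
  rw [fAB, schwartz_sum_apply]
  rfl

/-- `f ≥ 0`. [cite: OlevskiiUlanovskii2021, Prop 1 (proof), p.1208] -/
theorem re_fAB_nonneg (a : ℝ) (m : ℕ) (x : ℝ) : 0 ≤ (fAB a m x).re := by
  rw [fAB_apply, Complex.re_sum]
  exact Finset.sum_nonneg fun j _ => ψ_re_nonneg _

/-- `f ≥ 1` on `(a, b)` as soon as `⌊b − a⌋ < m` (p.1208: "`f(x) = 1, x ∈ (a,b)`"). [cite: OlevskiiUlanovskii2021, Prop 1 (proof), p.1208] -/
theorem one_le_re_fAB {a b x : ℝ} {m : ℕ} (hm : ⌊b - a⌋₊ < m) (hx : x ∈ Ioo a b) :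
    1 ≤ (fAB a m x).re := by
  rw [fAB_apply, Complex.re_sum]
  have hxa : 0 ≤ x - a := by linarith [hx.1]
  have hj : ⌊x - a⌋₊ ∈ Finset.range m := by
    rw [Finset.mem_range]
    exact lt_of_le_of_lt (Nat.floor_mono (by linarith [hx.2])) hm
  rw [← Finset.add_sum_erase _ _ hj]
  have h1 : ψ (x - (a + (⌊x - a⌋₊ : ℕ))) = 1 :=
    ψ_eq_one ⟨by linarith [Nat.floor_le hxa], by linarith [Nat.lt_floor_add_one (x - a)]⟩
  rw [h1, Complex.one_re]
  have : 0 ≤ ∑ j ∈ (Finset.range m).erase ⌊x - a⌋₊, (ψ (x - (a + (j : ℕ)))).re :=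
    Finset.sum_nonneg fun j _ => ψ_re_nonneg _
  linarith

/-- Translation does not change the modulus of the (inverse) Fourier transform. [cite: OlevskiiUlanovskii2021, Prop 1 (proof), p.1208] -/
theorem norm_fourierInv_compSubConst (v t : ℝ) (φ : 𝓢(ℝ, ℂ)) :
    ‖(𝓕⁻ (SchwartzMap.compSubConstCLM ℂ v φ) : 𝓢(ℝ, ℂ)) t‖ = ‖(𝓕⁻ φ : 𝓢(ℝ, ℂ)) t‖ := by
  rw [SchwartzMap.fourierInv_coe, SchwartzMap.fourierInv_coe, Real.fourierInv_eq_fourier_neg,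
    Real.fourierInv_eq_fourier_neg]
  have : ((SchwartzMap.compSubConstCLM ℂ v φ : 𝓢(ℝ, ℂ)) : ℝ → ℂ) =
      (φ : ℝ → ℂ) ∘ fun x => x + -v := by
    ext x
    simp [SchwartzMap.compSubConstCLM_apply, sub_eq_add_neg]
  rw [this]
  change ‖VectorFourier.fourierIntegral Real.fourierChar volume (innerₗ ℝ) _ (-t)‖ =
    ‖VectorFourier.fourierIntegral Real.fourierChar volume (innerₗ ℝ) _ (-t)‖
  rw [VectorFourier.fourierIntegral_comp_add_right]
  simp only [Circle.norm_smul]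

/-- `|𝓕⁻ f(t)| ≤ m |𝓕⁻ ψ(t)|` (p.1208: "`|f̂(t)| ≤ (1 + b − a)|ĝ(t)|`"). [cite: OlevskiiUlanovskii2021, Prop 1 (proof), p.1208] -/
theorem norm_fourierInv_fAB_le (a : ℝ) (m : ℕ) (t : ℝ) :
    ‖(𝓕⁻ (fAB a m) : 𝓢(ℝ, ℂ)) t‖ ≤ m * ‖(𝓕⁻ ψ : 𝓢(ℝ, ℂ)) t‖ := by
  rw [fAB, FourierTransform.fourierInv_sum, schwartz_sum_apply]
  calc ‖∑ j ∈ Finset.range m, (𝓕⁻ (SchwartzMap.compSubConstCLM ℂ (a + (j : ℕ)) ψ) : 𝓢(ℝ, ℂ)) t‖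
      ≤ ∑ j ∈ Finset.range m,
          ‖(𝓕⁻ (SchwartzMap.compSubConstCLM ℂ (a + (j : ℕ)) ψ) : 𝓢(ℝ, ℂ)) t‖ := norm_sum_le _ _
    _ = ∑ j ∈ Finset.range m, ‖(𝓕⁻ ψ : 𝓢(ℝ, ℂ)) t‖ :=
        Finset.sum_congr rfl fun j _ => norm_fourierInv_compSubConst _ _ _
    _ = m * ‖(𝓕⁻ ψ : 𝓢(ℝ, ℂ)) t‖ := by simp

/-- The spectral-side bound when `μ̂ = u ρ`: `|∫ u · 𝓕⁻f dρ| ≤ m ∫ |𝓕⁻ψ| dρ`. [cite: OlevskiiUlanovskii2021, Prop 1 (proof), p.1208] -/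
theorem norm_integral_mul_fourierInv_fAB_le (ρ : Measure ℝ) [ρ.HasTemperateGrowth] {u : ℝ → ℂ}
    (hu1 : ∀ t, ‖u t‖ ≤ 1) (a : ℝ) (m : ℕ) :
    ‖∫ t, u t * (𝓕⁻ (fAB a m) : 𝓢(ℝ, ℂ)) t ∂ρ‖ ≤
      m * ∫ t, ‖(𝓕⁻ ψ : 𝓢(ℝ, ℂ)) t‖ ∂ρ := by
  rw [← integral_const_mul]
  apply norm_integral_le_of_norm_le (((𝓕⁻ ψ : 𝓢(ℝ, ℂ)).integrable (μ := ρ)).norm.const_mul _)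
  filter_upwards with t
  calc ‖u t * (𝓕⁻ (fAB a m) : 𝓢(ℝ, ℂ)) t‖
      = ‖u t‖ * ‖(𝓕⁻ (fAB a m) : 𝓢(ℝ, ℂ)) t‖ := norm_mul _ _
    _ ≤ 1 * ‖(𝓕⁻ (fAB a m) : 𝓢(ℝ, ℂ)) t‖ := by gcongr; exact hu1 t
    _ ≤ (m : ℝ) * ‖(𝓕⁻ ψ : 𝓢(ℝ, ℂ)) t‖ := by rw [one_mul]; exact norm_fourierInv_fAB_le a m t

end OU2020Prop1

open OU2020Prop1 in
/-- **Proof of Olevskii–Ulanovskii 2020, Proposition 1** (discharges `OU2020_prop_1`), following the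
printed proof with the test function `Σ_{j<m} ψ(· − a − j)`; the constant is `C = ∫ |𝓕⁻ψ| d|μ̂|`.
[cite: OlevskiiUlanovskii2021, Prop 1] -/
theorem OU2020_prop_1_holds : OU2020_prop_1 := by
  intro μ ρ u hμ hρ _hu hu1 hdual
  set K : ℝ := ∫ t, ‖(𝓕⁻ ψ : 𝓢(ℝ, ℂ)) t‖ ∂ρ with hK
  have hK0 : 0 ≤ K := integral_nonneg fun _ => norm_nonneg _
  refine ⟨K, fun a b hab => ?_⟩
  obtain ⟨m, hm⟩ : ∃ m : ℕ, m = ⌊b - a⌋₊ + 1 := ⟨_, rfl⟩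
  have hm_lt : ⌊b - a⌋₊ < m := by omega
  have hm_le : (m : ℝ) ≤ 1 + (b - a) := by
    rw [hm]; push_cast; linarith [Nat.floor_le (sub_nonneg.2 hab.le)]
  have hfi : Integrable (fun x => (fAB a m x).re) μ := by
    simpa using ((fAB a m).integrable (μ := μ)).re
  have hA : μ (Ioo a b) ≤ ENNReal.ofReal (∫ x, (fAB a m x).re ∂μ) := by
    rw [ofReal_integral_eq_lintegral_ofReal hfi (Eventually.of_forall fun x => re_fAB_nonneg a m x),
      ← lintegral_indicator_one measurableSet_Ioo]
    apply lintegral_mono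
    intro x
    by_cases hx : x ∈ Ioo a b
    · rw [indicator_of_mem hx, Pi.one_apply]
      exact ENNReal.one_le_ofReal.2 (one_le_re_fAB hm_lt hx)
    · rw [indicator_of_notMem hx]
      exact bot_le
  have hB : ∫ x, (fAB a m x).re ∂μ ≤ (m : ℝ) * K := by
    have h1 : ∫ x, (fAB a m x).re ∂μ = (∫ x, fAB a m x ∂μ).re := by
      simpa using integral_re ((fAB a m).integrable (μ := μ))
    have h2 : ∫ x, fAB a m x ∂μ = ∫ t, u t * (𝓕⁻ (fAB a m) : 𝓢(ℝ, ℂ)) t ∂ρ := by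
      have := hdual (𝓕⁻ (fAB a m))
      rw [FourierTransform.fourier_fourierInv_eq] at this
      exact this
    calc ∫ x, (fAB a m x).re ∂μ = (∫ x, fAB a m x ∂μ).re := h1
      _ ≤ ‖∫ x, fAB a m x ∂μ‖ := Complex.re_le_norm _
      _ = ‖∫ t, u t * (𝓕⁻ (fAB a m) : 𝓢(ℝ, ℂ)) t ∂ρ‖ := by rw [h2]
      _ ≤ (m : ℝ) * K := norm_integral_mul_fourierInv_fAB_le ρ hu1 a m
  calc μ (Ioo a b) ≤ ENNReal.ofReal (∫ x, (fAB a m x).re ∂μ) := hA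
    _ ≤ ENNReal.ofReal (K * (1 + (b - a))) := by
        apply ENNReal.ofReal_le_ofReal
        calc ∫ x, (fAB a m x).re ∂μ ≤ (m : ℝ) * K := hB
          _ ≤ (1 + (b - a)) * K := by gcongr
          _ = K * (1 + (b - a)) := mul_comm _ _

/-! ### Proof of Corollary 1 (Olevskii–Ulanovskii 2020, p.1208)

Proposition 1 for the atomic datum `(Λ, 1)` gives `#(Λ ∩ (a,b)) ≤ C(1 + b − a)`; in particular every
open interval of length `1` carries at most `2C < M` points.  Number the points of `Λ` consecutively
(counting function `N`, `N(y) − N(x) = #(Λ ∩ [x,y))`) and split `Λ` into the `M` residue classes of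
`N mod M`: two points of one class at distance `< 1/2` would enclose `≥ M` points of `Λ` in an interval
of length `1`, a contradiction; so each class is uniformly discrete. -/

namespace OU2020Cor1

open OU2020Prop1

/-- In a locally finite `Λ ⊂ ℝ`, the points in a bounded interval form a finite set. [cite: OlevskiiUlanovskii2021, Cor 1 (proof), p.1208] -/
theorem finite_inter_of_subset_Icc {Λ : Set ℝ} (hΛ : IsLocallyFiniteSet Λ) {s : Set ℝ} {a b : ℝ}
    (hs : s ⊆ Icc a b) : (Λ ∩ s).Finite := by
  refine (hΛ 0 (max |a| |b|)).subset ?_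
  rintro z ⟨hz, hzs⟩
  refine ⟨hz, ?_⟩
  rw [Metric.mem_closedBall, dist_zero_right, Real.norm_eq_abs, abs_le]
  have := hs hzs
  constructor
  · linarith [this.1, neg_abs_le a, le_max_left |a| |b|]
  · linarith [this.2, le_abs_self b, le_max_right |a| |b|]

/-- **Proposition 1 for the atomic measure `μ = Σ_{λ∈Λ} δ_λ`**, with the spectral side abstracted into
the bound `|⟨μ, 𝓕⁻f⟩| ≤ m K` for the test functions `f = fAB a m`:
`#(Λ ∩ (a,b)) ≤ K (1 + b − a)`. [cite: OlevskiiUlanovskii2021, Prop 1] -/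
theorem ncard_inter_Ioo_le {Λ : Set ℝ} (hΛ : IsLocallyFiniteSet Λ)
    (h1 : HasTemperedMasses Λ (fun _ => (1 : ℂ))) {K : ℝ}
    (hK : ∀ (a : ℝ) (m : ℕ), ‖∑' x : Λ, fAB a m x‖ ≤ m * K) {a b : ℝ} (hab : a < b) :
    ((Λ ∩ Ioo a b).ncard : ℝ) ≤ K * (1 + (b - a)) := by
  classical
  have hK0 : 0 ≤ K := by simpa using (norm_nonneg _).trans (hK a 1)
  obtain ⟨m, hm⟩ : ∃ m : ℕ, m = ⌊b - a⌋₊ + 1 := ⟨_, rfl⟩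
  have hm_lt : ⌊b - a⌋₊ < m := by omega
  have hm_le : (m : ℝ) ≤ 1 + (b - a) := by
    rw [hm]; push_cast; linarith [Nat.floor_le (sub_nonneg.2 hab.le)]
  have hsum : Summable (fun x : Λ => fAB a m x) := by
    simpa using h1.summable_mul_schwartz hΛ (fAB a m)
  have hsum_re : Summable (fun x : Λ => (fAB a m x).re) := Complex.reCLM.summable hsum
  have hfin : (Λ ∩ Ioo a b).Finite := finite_inter_of_subset_Icc hΛ Ioo_subset_Icc_self
  let F : Finset Λ := hfin.toFinset.subtype (· ∈ Λ)
  have hF_mem : ∀ x ∈ F, (x : ℝ) ∈ Ioo a b := by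
    intro x hx
    rw [Finset.mem_subtype, Set.Finite.mem_toFinset] at hx
    exact hx.2
  have hF_card : F.card = (Λ ∩ Ioo a b).ncard := by
    rw [Set.ncard_eq_toFinset_card _ hfin, Finset.card_subtype]
    congr 1
    ext x
    simp only [Finset.mem_filter, Set.Finite.mem_toFinset, mem_inter_iff, and_iff_left_iff_imp]
    exact fun h => h.1
  calc ((Λ ∩ Ioo a b).ncard : ℝ) = ∑ x ∈ F, (1 : ℝ) := by simp [hF_card]
    _ ≤ ∑ x ∈ F, (fAB a m x).re := Finset.sum_le_sum fun x hx => one_le_re_fAB hm_lt (hF_mem x hx)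
    _ ≤ ∑' x : Λ, (fAB a m x).re := hsum_re.sum_le_tsum F (fun x _ => re_fAB_nonneg a m x)
    _ = (∑' x : Λ, fAB a m x).re := (Complex.re_tsum hsum).symm
    _ ≤ ‖∑' x : Λ, fAB a m x‖ := Complex.re_le_norm _
    _ ≤ m * K := hK a m
    _ ≤ (1 + (b - a)) * K := by gcongr
    _ = K * (1 + (b - a)) := mul_comm _ _

/-- The **counting function** of `Λ`: `N(x) = #(Λ ∩ [0,x))` for `x ≥ 0` and `−#(Λ ∩ [x,0))` for
`x < 0`, so that `N(y) − N(x) = #(Λ ∩ [x,y))`. [folklore] -/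
def countFn (Λ : Set ℝ) (x : ℝ) : ℤ :=
  ((Λ ∩ Ico 0 x).ncard : ℤ) - ((Λ ∩ Ico x 0).ncard : ℤ)

/-- `N(y) − N(x) = #(Λ ∩ [x, y))` for `x ≤ y`. [cite: OlevskiiUlanovskii2021, Cor 1 (proof), p.1208] -/
theorem countFn_sub {Λ : Set ℝ} (hΛ : IsLocallyFiniteSet Λ) {x y : ℝ} (hxy : x ≤ y) :
    countFn Λ y - countFn Λ x = ((Λ ∩ Ico x y).ncard : ℤ) := by
  have hf : ∀ a b : ℝ, (Λ ∩ Ico a b).Finite := fun a b =>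
    finite_inter_of_subset_Icc hΛ Ico_subset_Icc_self
  have hempty : ∀ a b : ℝ, b ≤ a → Λ ∩ Ico a b = ∅ := fun a b h => by
    rw [Ico_eq_empty (not_lt.2 h), inter_empty]
  have hsplit : ∀ a b c : ℝ, a ≤ b → b ≤ c →
      ((Λ ∩ Ico a c).ncard : ℤ) = (Λ ∩ Ico a b).ncard + (Λ ∩ Ico b c).ncard := by
    intro a b c hab hbc
    rw [← Ico_union_Ico_eq_Ico hab hbc, inter_union_distrib_left,
      Set.ncard_union_eq (Disjoint.mono inter_subset_right inter_subset_right
        Ico_disjoint_Ico_same) (hf _ _) (hf _ _)]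
    push_cast
    ring
  unfold countFn
  rcases le_total 0 x with hx | hx
  · rw [hempty x 0 hx, hempty y 0 (hx.trans hxy), hsplit 0 x y hx hxy]
    simp only [Set.ncard_empty, Nat.cast_zero]
    ring
  · rcases le_total 0 y with hy | hy
    · rw [hempty 0 x hx, hempty y 0 hy, hsplit x 0 y hx hy]
      simp only [Set.ncard_empty, Nat.cast_zero]
      ring
    · rw [hempty 0 x hx, hempty 0 y hy, hsplit x y 0 hxy hy]
      simp only [Set.ncard_empty, Nat.cast_zero]
      ring

/-- **Combinatorial core of Corollary 1**: a locally finite `Λ ⊂ ℝ` with `#(Λ ∩ (a,b)) ≤ C(1 + b − a)`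
for all `a < b` is a union of `⌊2C⌋ + 1` uniformly discrete sets (residue classes of the counting
function). [cite: OlevskiiUlanovskii2021, Cor 1] -/
theorem isRelativelyUniformlyDiscrete_of_ncard_le {Λ : Set ℝ} (hΛ : IsLocallyFiniteSet Λ) {C : ℝ}
    (hC : ∀ a b : ℝ, a < b → ((Λ ∩ Ioo a b).ncard : ℝ) ≤ C * (1 + (b - a))) :
    IsRelativelyUniformlyDiscrete Λ := by
  classical
  obtain ⟨M, hM1, hMC⟩ : ∃ M : ℕ, 1 ≤ M ∧ 2 * C < M :=
    ⟨⌊2 * C⌋₊ + 1, by omega, by push_cast; linarith [Nat.lt_floor_add_one (2 * C)]⟩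
  have hM0 : (0 : ℤ) < M := by exact_mod_cast hM1
  refine ⟨M, fun i => {x | x ∈ Λ ∧ countFn Λ x % (M : ℤ) = (i : ℕ)}, fun i => ?_, ?_⟩
  · refine ⟨2⁻¹, by norm_num, fun x hx y hy hne => ?_⟩
    by_contra hlt
    rw [not_le] at hlt
    wlog hxy : x < y generalizing x y
    · exact this y hy x hx hne.symm (by rwa [dist_comm]) (lt_of_le_of_ne (not_lt.1 hxy) hne.symm)
    have hmod : Int.ModEq M (countFn Λ x) (countFn Λ y) := hx.2.trans hy.2.symm
    have hdvd : (M : ℤ) ∣ countFn Λ y - countFn Λ x := hmod.dvd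
    have hfin : (Λ ∩ Ico x y).Finite := finite_inter_of_subset_Icc hΛ Ico_subset_Icc_self
    have hge1 : 1 ≤ countFn Λ y - countFn Λ x := by
      rw [countFn_sub hΛ hxy.le]
      have : 0 < (Λ ∩ Ico x y).ncard := (Set.ncard_pos hfin).2 ⟨x, hx.1, left_mem_Ico.2 hxy⟩
      omega
    have hgeM : (M : ℤ) ≤ countFn Λ y - countFn Λ x := Int.le_of_dvd (by omega) hdvd
    have hdist : y < x + 2⁻¹ := by
      rw [Real.dist_eq, abs_sub_comm, abs_of_pos (sub_pos.2 hxy)] at hlt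
      linarith
    have hsub : Λ ∩ Ico x y ⊆ Λ ∩ Ioo (x - 2⁻¹) (x + 2⁻¹) := fun z hz =>
      ⟨hz.1, by linarith [hz.2.1], by linarith [hz.2.2]⟩
    have hcnt : ((Λ ∩ Ico x y).ncard : ℝ) ≤ 2 * C := by
      calc ((Λ ∩ Ico x y).ncard : ℝ) ≤ ((Λ ∩ Ioo (x - 2⁻¹) (x + 2⁻¹)).ncard : ℝ) := by
            exact_mod_cast Set.ncard_le_ncard hsub
              (finite_inter_of_subset_Icc hΛ Ioo_subset_Icc_self)
        _ ≤ C * (1 + (x + 2⁻¹ - (x - 2⁻¹))) := hC _ _ (by linarith)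
        _ = 2 * C := by ring
    have hM_le : (M : ℝ) ≤ ((Λ ∩ Ico x y).ncard : ℝ) := by
      have h := hgeM
      rw [countFn_sub hΛ hxy.le] at h
      exact_mod_cast h
    linarith
  · ext x
    simp only [mem_iUnion, mem_setOf_eq]
    constructor
    · intro hx
      have h0 : 0 ≤ countFn Λ x % (M : ℤ) := Int.emod_nonneg _ (by omega)
      have h1 : countFn Λ x % (M : ℤ) < M := Int.emod_lt_of_pos _ hM0
      refine ⟨⟨(countFn Λ x % (M : ℤ)).toNat, by omega⟩, hx, ?_⟩
      simp only
      omega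
    · rintro ⟨i, hx, -⟩
      exact hx

end OU2020Cor1

open OU2020Prop1 OU2020Cor1 in
/-- **Proof of Olevskii–Ulanovskii 2020, Corollary 1** (discharges `OU2020_cor_1`): Proposition 1 for
`μ = Σ_{λ∈Λ} δ_λ` and the residue-class splitting of the counting function.
[cite: OlevskiiUlanovskii2021, Cor 1] -/
theorem OU2020_cor_1_holds : OU2020_cor_1 := by
  intro Λ ρ u hΛ h1 hρ _hu hu1 hdual
  refine isRelativelyUniformlyDiscrete_of_ncard_le hΛ
    (C := ∫ t, ‖(𝓕⁻ ψ : 𝓢(ℝ, ℂ)) t‖ ∂ρ) fun a b hab => ncard_inter_Ioo_le hΛ h1 (fun a m => ?_) hab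
  have := hdual (𝓕⁻ (fAB a m))
  rw [FourierTransform.fourier_fourierInv_eq] at this
  rw [this]
  exact norm_integral_mul_fourierInv_fAB_le ρ hu1 a m

open OU2020Prop1 in
/-- The spectral-side bound when `μ̂ = Σ_{s∈S} a_s δ_s` is atomic with tempered masses:
`|Σ_s a_s 𝓕⁻f(s)| ≤ m Σ_s |a_s| |𝓕⁻ψ(s)|`. [cite: OlevskiiUlanovskii2021, Cor 1 (proof), p.1208] -/
theorem OU2020Cor1.norm_tsum_mul_fourierInv_fAB_le {S : Set ℝ} (hS : IsLocallyFiniteSet S)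
    {a : ℝ → ℂ} (ha : HasTemperedMasses S a) (a' : ℝ) (m : ℕ) :
    ‖∑' s : S, a s * (𝓕⁻ (fAB a' m) : 𝓢(ℝ, ℂ)) s‖ ≤
      m * ∑' s : S, ‖a s * (𝓕⁻ ψ : 𝓢(ℝ, ℂ)) s‖ := by
  have hKs : Summable (fun s : S => ‖a s * (𝓕⁻ ψ : 𝓢(ℝ, ℂ)) s‖) :=
    ha.summable_norm_mul_schwartz hS _
  have hle : ∀ s : S,
      ‖a s * (𝓕⁻ (fAB a' m) : 𝓢(ℝ, ℂ)) s‖ ≤ (m : ℝ) * ‖a s * (𝓕⁻ ψ : 𝓢(ℝ, ℂ)) s‖ := by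
    intro s
    rw [norm_mul, norm_mul]
    calc ‖a s‖ * ‖(𝓕⁻ (fAB a' m) : 𝓢(ℝ, ℂ)) s‖
        ≤ ‖a s‖ * (m * ‖(𝓕⁻ ψ : 𝓢(ℝ, ℂ)) s‖) := by
          gcongr
          exact norm_fourierInv_fAB_le a' m s
      _ = (m : ℝ) * (‖a s‖ * ‖(𝓕⁻ ψ : 𝓢(ℝ, ℂ)) s‖) := by ring
  have hsum' : Summable (fun s : S => ‖a s * (𝓕⁻ (fAB a' m) : 𝓢(ℝ, ℂ)) s‖) :=
    Summable.of_nonneg_of_le (fun _ => norm_nonneg _) hle (hKs.mul_left _)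
  calc ‖∑' s : S, a s * (𝓕⁻ (fAB a' m) : 𝓢(ℝ, ℂ)) s‖
      ≤ ∑' s : S, ‖a s * (𝓕⁻ (fAB a' m) : 𝓢(ℝ, ℂ)) s‖ := norm_tsum_le_tsum_norm hsum'
    _ ≤ ∑' s : S, (m : ℝ) * ‖a s * (𝓕⁻ ψ : 𝓢(ℝ, ℂ)) s‖ := hsum'.tsum_le_tsum hle (hKs.mul_left _)
    _ = m * ∑' s : S, ‖a s * (𝓕⁻ ψ : 𝓢(ℝ, ℂ)) s‖ := tsum_mul_left

open OU2020Prop1 OU2020Cor1 in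
/-- **Proposition 1 for unit-mass Fourier quasicrystals**: `#(Λ ∩ (a,b)) ≤ C (1 + b − a)` — the support
of an FQ `Σ_{λ∈Λ} δ_λ` has uniformly bounded density on intervals. [cite: OlevskiiUlanovskii2021, Prop 1] -/
theorem IsFourierQuasicrystal.exists_ncard_inter_Ioo_le {Λ S : Set ℝ} {a : ℝ → ℂ}
    (h : IsFourierQuasicrystal Λ (fun _ => 1) S a) :
    ∃ C : ℝ, ∀ a' b : ℝ, a' < b → ((Λ ∩ Ioo a' b).ncard : ℝ) ≤ C * (1 + (b - a')) := by
  refine ⟨∑' s : S, ‖a s * (𝓕⁻ ψ : 𝓢(ℝ, ℂ)) s‖, fun a' b hab =>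
    ncard_inter_Ioo_le h.locallyFinite_support h.temperedMasses_support (fun a' m => ?_) hab⟩
  have hd := h.duality (𝓕⁻ (fAB a' m))
  rw [FourierTransform.fourier_fourierInv_eq] at hd
  simp only [one_mul] at hd
  rw [hd]
  exact norm_tsum_mul_fourierInv_fAB_le h.locallyFinite_spectrum h.temperedMasses_spectrum a' m

open OU2020Cor1 in
/-- **Corollary 1 for unit-mass Fourier quasicrystals**: the support of an FQ `Σ_{λ∈Λ} δ_λ` is
relatively uniformly discrete (the form in which the paper uses Corollary 1: "In what follows we assume
that `μ` is an FQ of the form (1)"). [cite: OlevskiiUlanovskii2021, Cor 1] -/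
theorem IsFourierQuasicrystal.isRelativelyUniformlyDiscrete {Λ S : Set ℝ} {a : ℝ → ℂ}
    (h : IsFourierQuasicrystal Λ (fun _ => 1) S a) : IsRelativelyUniformlyDiscrete Λ := by
  obtain ⟨C, hC⟩ := h.exists_ncard_inter_Ioo_le
  exact isRelativelyUniformlyDiscrete_of_ncard_le h.locallyFinite_support hC


/-! ### The elementary rendering is equivalent to the printed definition

"FQ = crystalline measure with `|μ|`, `|μ̂|` tempered" (§1): `IsFourierQuasicrystal Λ c S a ↔
IsCrystallineMeasure Λ c S a ∧ HasTemperedMasses Λ c ∧ HasTemperedMasses S a`.  The direction `⇐` uses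
that compactly supported Schwartz functions are dense in `𝓢` (Hörmander I, Lemma 7.1.8; the tree's
`Literature.MathematicalPhysics.QuantumLattice.exists_tsupport_subset_inter_closedBall_tendsto`), so a
tempered distribution is determined by its values on them. -/

section Equivalence

variable {V : Type*} [NormedAddCommGroup V] [InnerProductSpace ℝ V] [FiniteDimensional ℝ V]
  [MeasurableSpace V] [BorelSpace V]
variable {Λ S : Set V} {c a : V → ℂ}

omit [MeasurableSpace V] [BorelSpace V] in
/-- Two tempered distributions which agree on compactly supported Schwartz functions are equal
(density of `C_c^∞` in `𝓢`, Hörmander I, Lemma 7.1.8, via the tree's bump cut-offs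
`exists_tsupport_subset_inter_closedBall_tendsto`; cf. the same argument in
`Literature.Analysis.FunctionSpaces.BesovWeakStarLimits`). [folklore] -/
private theorem temperedDistribution_eq_of_forall_hasCompactSupport {W₁ W₂ : 𝓢'(V, ℂ)}
    (h : ∀ θ : 𝓢(V, ℂ), HasCompactSupport (θ : V → ℂ) → W₁ θ = W₂ θ) : W₁ = W₂ := by
  ext θ
  obtain ⟨u, hu, hlim⟩ :=
    Literature.MathematicalPhysics.QuantumLattice.exists_tsupport_subset_inter_closedBall_tendsto θ
  have hcs : ∀ m, HasCompactSupport ((u m : 𝓢(V, ℂ)) : V → ℂ) := fun m =>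
    IsCompact.of_isClosed_subset (isCompact_closedBall (0 : V) _) (isClosed_tsupport _)
      ((hu m).trans inter_subset_right)
  have h1 : Tendsto (fun m => W₁ (u m)) atTop (𝓝 (W₁ θ)) := (W₁.continuous.tendsto θ).comp hlim
  have h2 : Tendsto (fun m => W₂ (u m)) atTop (𝓝 (W₂ θ)) := (W₂.continuous.tendsto θ).comp hlim
  have he : (fun m => W₁ (u m)) = fun m => W₂ (u m) := funext fun m => h (u m) (hcs m)
  rw [he] at h1
  exact tendsto_nhds_unique h1 h2

/-- For a crystalline measure with tempered masses, the tempered distribution `T` of the definition *is*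
`φ ↦ Σ_{λ∈Λ} c_λ φ(λ)` on all of `𝓢`. [cite: OlevskiiUlanovskii2021, §1 p.1207] -/
theorem IsCrystallineMeasure.temperedDistribution_eq (h : IsCrystallineMeasure Λ c S a)
    (hc : HasTemperedMasses Λ c) {T : 𝓢'(V, ℂ)}
    (hT : ∀ φ : 𝓢(V, ℂ), HasCompactSupport φ → T φ = ∑' x : Λ, c x * φ x) :
    T = hc.temperedDistribution h.locallyFinite_support :=
  temperedDistribution_eq_of_forall_hasCompactSupport fun θ hθ => by
    rw [hT θ hθ, HasTemperedMasses.temperedDistribution_apply]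

/-- **The printed definition implies the elementary rendering**: a crystalline measure whose masses
`|μ|` and spectral masses `|μ̂|` are tempered is a Fourier quasicrystal in the sense of
`IsFourierQuasicrystal` (duality on *all* Schwartz functions). [cite: OlevskiiUlanovskii2021, §1 p.1207] -/
theorem IsCrystallineMeasure.isFourierQuasicrystal (h : IsCrystallineMeasure Λ c S a)
    (hc : HasTemperedMasses Λ c) (ha : HasTemperedMasses S a) : IsFourierQuasicrystal Λ c S a where
  locallyFinite_support := h.locallyFinite_support
  locallyFinite_spectrum := h.locallyFinite_spectrum
  temperedMasses_support := hc
  temperedMasses_spectrum := ha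
  duality φ := by
    obtain ⟨T, hT, hFT⟩ := h.exists_temperedDistribution
    have h1 : T = hc.temperedDistribution h.locallyFinite_support := h.temperedDistribution_eq hc hT
    have h2 : 𝓕 T = ha.temperedDistribution h.locallyFinite_spectrum :=
      temperedDistribution_eq_of_forall_hasCompactSupport fun θ hθ => by
        rw [hFT θ hθ, HasTemperedMasses.temperedDistribution_apply]
    calc ∑' x : Λ, c x * 𝓕 φ x
        = hc.temperedDistribution h.locallyFinite_support (𝓕 φ) :=
          (HasTemperedMasses.temperedDistribution_apply _ _ _).symm
      _ = 𝓕 T φ := by rw [TemperedDistribution.fourier_apply, h1]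
      _ = ∑' s : S, a s * φ s := by rw [h2, HasTemperedMasses.temperedDistribution_apply]

/-- **Fourier quasicrystal = crystalline measure with `|μ|` and `|μ̂|` tempered** — the printed
definition (§1, p.1207: "If in addition the measures `|μ|` and `|μ̂|` are also tempered, then `μ` is
called a Fourier quasicrystal") is equivalent to the elementary rendering `IsFourierQuasicrystal`.
[cite: OlevskiiUlanovskii2021, §1 p.1207] -/
theorem isFourierQuasicrystal_iff_isCrystallineMeasure :
    IsFourierQuasicrystal Λ c S a ↔
      IsCrystallineMeasure Λ c S a ∧ HasTemperedMasses Λ c ∧ HasTemperedMasses S a :=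
  ⟨fun h => ⟨h.isCrystallineMeasure, h.temperedMasses_support, h.temperedMasses_spectrum⟩,
    fun h => h.1.isFourierQuasicrystal h.2.1 h.2.2⟩

end Equivalence

end

end Literature.Analysis.Fourier
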